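import Mathlib
import Literature.Probability.Moments.HoeffdingDecomposition
import Literature.Computability.Complexity.RandomKSatLowDegreeHardness

/-!
# Route OverlapGapAlgebra, crux `SearchHardWindow` (stmt-PneNP-2460): VANISHING success of
# low-degree search maps — the three supporting lemmas

(Supporting lemmas of `…VanishingLowDegree.lean`; the theorem they serve:)
**Theorem (`vanishingLowDegreeHardness`).** There is `k₀` such that for every `k ≥ k₀`, every
energy constant `C`, every coordinate-degree sequence `D_n = o(n / log² n)` and every sequence of
vector-valued maps `F_n` on the literal arrays of `F_k(n, ⌊5·2^k log k/k · n⌋)` with coordinate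
(Efron–Stein) degree `≤ D_n` and energy `Σ_Φ ‖F_n(Φ)‖² ≤ C n · #Φ`: for every `ε > 0`, eventually in
`n`, the literal arrays on which every `|F_n(Φ)_v| ≥ 1` AND the sign assignment satisfies `Φ` number
at most `ε · #Φ`. This is the conclusion of Huang–Sellke 2025, Cor. 3.21 (the tree's named fact
`Literature.Computability.Complexity.HuangSellke2025KSat`, deterministic saturated form) — success
probability `→ 0`, not merely bounded away from `1` — for degrees `o(n/log² n)` (HS25: `o(n)`), with
NO named fact and NO hypothesis: the route's crux `NoStableSection` is a theorem, and so is its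
macro-step form `macroNoStableSection` (`…MacroNoStableSection.lean`).

Mechanism (new; replaces Huang–Sellke's reversible-ensemble boosting, their Lemma 3.1, which does not
apply to the inhomogeneous Bresler–Huang scan): read the interpolation path only at CHECKPOINTS every
`L` literals. The block form of the scan correlation inequality (`scanCorrelation_blockPaths`,
`…BlockPaths.lean`: the success set of density `p` pays `p^{k·⌈m/L⌉·k+1} ≈ p^{k²αn/L}`, stability a
defect `exp(O(L log n · √(nD/L)))`) against the `e^{-cn}` ceiling of `macroNoStableSection` (uniform
in `L`) gives `(k²α/L)·log(1/p) ≳ c`, i.e. `p ≤ e^{-cL/(k²α)}`: for a target `ε` take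
`L ≈ (4k²α/c) log(1/ε)`. Supporting lemmas: `vld_farCount_le` (low block-degree ⇒ few large
`L²`-jumps under block resampling, Hoeffding decomposition on the block alphabet),
`vld_degree_of_pullback` (coordinate degree is preserved by coordinatewise pull-backs — the padded
map `F ∘ proj` has block degree `≤ D`), `vld_defect_arith` (the defect is `≤ cn/4`).

References: G. Bresler, B. Huang, FOCS 2021 / arXiv:2106.02129, Thm. 2.6 [BreslerHuang2022];
B. Huang, M. Sellke, arXiv:2501.06427, Cor. 3.21 [HuangSellke2025]; R. O'Donnell, *Analysis of
Boolean Functions*, CUP 2014, §8.3–8.4 [ODonnell2014].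
-/

namespace Summit.PneNP.PneNP.Theorems

set_option linter.dupNamespace false -- `Summit.PneNP.PneNP.…`: summit = sub-problem (D-0017)

open Finset Filter Asymptotics
open Literature.Computability.Complexity (IsCoordDegreeLE)
open Literature.Probability.Moments
open scoped Classical

/-! ### Low block-degree ⇒ few large `L²`-jumps (general alphabet) -/

/-- **Low coordinate degree ⇒ few large `L²`-jumps, general alphabet** (`cld_farCount_le` of
`…ConstLowDegree.lean` with the literal alphabet `Fin n × Bool` replaced by an arbitrary finite
alphabet `Γ`; used with the BLOCK alphabet `Fin L → Fin n × Bool`). For `F : (Fin m → Fin k → Γ) → ℝⁿ`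
whose coordinates have coordinate degree `≤ D` in the `m·k` slots and `η n > 0`, the number of
(array, slot, fresh symbol) triples with `Σ_v (F(Φ)_v − F(Φ')_v)² > η n` is at most
`(2 D |Γ|/(η n)) · Σ_Φ ‖F Φ‖²` (Markov + `sum_sum_sum_sq_sub_update_le`). [ODonnell2014, §8.4] -/
theorem vld_farCount_le {m k n : ℕ} {Γ : Type*} [Fintype Γ] [Nonempty Γ] (hn : 1 ≤ n) {η : ℝ}
    (hη : 0 < η) {D : ℕ} (F : (Fin m → Fin k → Γ) → Fin n → ℝ)
    (hdeg : ∀ v, IsCoordDegreeLE D (fun y : Fin m × Fin k → Γ => F (Function.curry y) v)) :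
    (∑ a : Fin m, ∑ b : Fin k,
        (((Finset.univ : Finset ((Fin m → Fin k → Γ) × Γ)).filter
          fun p => η * n < ∑ v, (F p.1 v -
            F (Function.update p.1 a (Function.update (p.1 a) b p.2)) v) ^ 2).card : ℝ))
      ≤ 2 * D * Fintype.card Γ / (η * n) * ∑ Φ : Fin m → Fin k → Γ, ∑ v, F Φ v ^ 2 := by
  have hn' : (0 : ℝ) < n := by exact_mod_cast hn
  have hηn : 0 < η * n := mul_pos hη hn'
  set f : Fin m → Fin k → (Fin m → Fin k → Γ) × Γ → Fin n → ℝ :=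
    fun a b p v => (F p.1 v - F (Function.update p.1 a (Function.update (p.1 a) b p.2)) v) ^ 2
    with hf
  -- (1) Markov per slot
  have hslot : ∀ (a : Fin m) (b : Fin k),
      (((Finset.univ : Finset ((Fin m → Fin k → Γ) × Γ)).filter
          fun p => η * n < ∑ v, f a b p v).card : ℝ) ≤ (η * n)⁻¹ * ∑ p, ∑ v, f a b p v := by
    intro a b
    rw [Finset.card_filter, Nat.cast_sum, Finset.mul_sum]
    refine Finset.sum_le_sum fun p _ => ?_
    have h0 : 0 ≤ ∑ v, f a b p v := sum_nonneg fun v _ => by rw [hf]; exact sq_nonneg _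
    split_ifs with hj
    · push_cast
      calc (1 : ℝ) = (η * n)⁻¹ * (η * n) := by rw [inv_mul_cancel₀ hηn.ne']
        _ ≤ (η * n)⁻¹ * ∑ v, f a b p v := mul_le_mul_of_nonneg_left hj.le (inv_nonneg.2 hηn.le)
    · push_cast
      exact mul_nonneg (inv_nonneg.2 hηn.le) h0
  -- (2) the Hoeffding bound on the total squared movement, per output coordinate `v`
  have hcurry : ∀ (G : (Fin m → Fin k → Γ) → ℝ),
      ∑ Φ, G Φ = ∑ y : Fin m × Fin k → Γ, G (Function.curry y) := fun G =>
    (Fintype.sum_equiv (Equiv.curry _ _ _) _ _ fun _ => rfl).symm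
  have hv : ∀ v : Fin n, ∑ a : Fin m, ∑ b : Fin k, ∑ Φ : Fin m → Fin k → Γ,
      ∑ ℓ : Γ, (F Φ v - F (Function.update Φ a (Function.update (Φ a) b ℓ)) v) ^ 2 ≤
        2 * D * Fintype.card Γ * ∑ Φ : Fin m → Fin k → Γ, F Φ v ^ 2 := by
    intro v
    have h := sum_sum_sum_sq_sub_update_le (hdeg v)
    rw [Fintype.sum_prod_type] at h
    simp only [Function.curry_update] at h
    have e1 : ∀ (a : Fin m) (b : Fin k), ∑ y : Fin m × Fin k → Γ, ∑ ℓ : Γ,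
        (F (Function.curry y) v -
          F (Function.update (Function.curry y) a (Function.update (Function.curry y a) b ℓ)) v) ^ 2 =
        ∑ Φ : Fin m → Fin k → Γ, ∑ ℓ : Γ,
          (F Φ v - F (Function.update Φ a (Function.update (Φ a) b ℓ)) v) ^ 2 := fun a b =>
      (hcurry fun Φ => ∑ ℓ : Γ,
        (F Φ v - F (Function.update Φ a (Function.update (Φ a) b ℓ)) v) ^ 2).symm
    have e2 : ∑ y : Fin m × Fin k → Γ, F (Function.curry y) v ^ 2 =
        ∑ Φ : Fin m → Fin k → Γ, F Φ v ^ 2 := (hcurry fun Φ => F Φ v ^ 2).symm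
    simp only [e1, e2] at h
    exact h
  have hhoef : ∑ a : Fin m, ∑ b : Fin k, ∑ p, ∑ v, f a b p v ≤
      2 * D * Fintype.card Γ * ∑ Φ : Fin m → Fin k → Γ, ∑ v, F Φ v ^ 2 := by
    calc ∑ a : Fin m, ∑ b : Fin k, ∑ p, ∑ v, f a b p v
        = ∑ a : Fin m, ∑ b : Fin k, ∑ v, ∑ p, f a b p v :=
          sum_congr rfl fun a _ => sum_congr rfl fun b _ => sum_comm
      _ = ∑ a : Fin m, ∑ v, ∑ b : Fin k, ∑ p, f a b p v := sum_congr rfl fun a _ => sum_comm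
      _ = ∑ v, ∑ a : Fin m, ∑ b : Fin k, ∑ p, f a b p v := sum_comm
      _ = ∑ v, ∑ a : Fin m, ∑ b : Fin k, ∑ Φ : Fin m → Fin k → Γ,
            ∑ ℓ : Γ, (F Φ v - F (Function.update Φ a (Function.update (Φ a) b ℓ)) v) ^ 2 := by
          simp only [hf, Fintype.sum_prod_type (f := fun p : (Fin m → Fin k → Γ) × Γ => _)]
      _ ≤ ∑ v, 2 * D * Fintype.card Γ * ∑ Φ : Fin m → Fin k → Γ, F Φ v ^ 2 :=
          sum_le_sum fun v _ => hv v
      _ = 2 * D * Fintype.card Γ * ∑ Φ : Fin m → Fin k → Γ, ∑ v, F Φ v ^ 2 := by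
          rw [← mul_sum, sum_comm]
  -- (3) assemble
  calc _ ≤ ∑ a : Fin m, ∑ b : Fin k, (η * n)⁻¹ * ∑ p, ∑ v, f a b p v :=
        sum_le_sum fun a _ => sum_le_sum fun b _ => hslot a b
    _ = (η * n)⁻¹ * ∑ a : Fin m, ∑ b : Fin k, ∑ p, ∑ v, f a b p v := by
        simp only [← mul_sum]
    _ ≤ (η * n)⁻¹ * (2 * D * Fintype.card Γ * ∑ Φ, ∑ v, F Φ v ^ 2) := by gcongr
    _ = 2 * D * Fintype.card Γ / (η * n) * ∑ Φ, ∑ v, F Φ v ^ 2 := by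
        field_simp

/-! ### Coordinate degree under coordinatewise pull-backs -/

/-- **Coordinate degree is preserved by coordinatewise pull-backs.** If `π : (κ → Δ) → (ι → Γ)`
reads coordinate `i` of its output from coordinate `β i` of its input only, then `F ∘ π` has
coordinate degree `≤ D` whenever `F` does (a `D`-junta on `T` pulls back to a junta on `β(T)`,
`#β(T) ≤ #T`). Used for the padded map `Φ̂ ↦ F (proj Φ̂)`, whose block degree is at most the literal
degree of `F`. [HuangSellke2025, §3.3] -/
theorem vld_degree_of_pullback {ι κ Γ Δ : Type*} [DecidableEq κ] {D : ℕ} {F : (ι → Γ) → ℝ}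
    (hF : IsCoordDegreeLE D F) (β : ι → κ) (π : (κ → Δ) → (ι → Γ))
    (hπ : ∀ (y y' : κ → Δ) (i : ι), y (β i) = y' (β i) → π y i = π y' i) :
    IsCoordDegreeLE D (fun y => F (π y)) := by
  obtain ⟨𝒮, G, h𝒮, hFsum⟩ := hF
  have hterm : ∀ T ∈ 𝒮, IsCoordDegreeLE D (fun y : κ → Δ => G T (π y)) := by
    intro T hT
    refine IsCoordDegreeLE.of_dependsOn (T.image β) (Finset.card_image_le.trans (h𝒮 T hT).1) ?_
    intro y y' hyy'
    refine (h𝒮 T hT).2 fun i hi => hπ y y' i (hyy' (β i) ?_)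
    simp only [Finset.coe_image, Set.mem_image, Finset.mem_coe]
    exact ⟨i, hi, rfl⟩
  have h := IsCoordDegreeLE.sum 𝒮 hterm
  have hfun : (fun y : κ → Δ => ∑ T ∈ 𝒮, G T (π y)) = fun y => F (π y) := by
    funext y; rw [hFsum]
  rw [hfun] at h
  exact h

/-! ### The defect arithmetic -/

/-- The defect of the block scan correlation inequality is at most `c₀ n / 4` (pure real
arithmetic; `V = Q·J` is the padded instance count, `s ≥ ε Q` the success count, `T` the number of
block steps, `NL` the block alphabet size with `log(2·NL) ≤ 4 L log n`, `D ≤ θ n/log² n`). -/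
theorem vld_defect_arith {NL Q J s V T D C η c₀ ε θ Lr kr α n lg : ℝ}
    (hNL : 0 < NL) (hQ : 0 < Q) (hJ : 0 < J) (hε : 0 < ε) (hs : ε * Q ≤ s) (hη : 0 < η)
    (hC : 0 < C) (hc₀ : 0 < c₀) (hn : 0 < n) (hlg : 0 < lg) (hL : 1 ≤ Lr) (hk : 1 ≤ kr)
    (hα : 1 ≤ α) (hV : V = Q * J) (hlog : Real.log (2 * NL) ≤ 4 * Lr * lg)
    (hT0 : 0 ≤ T) (hT : T ≤ 2 * kr ^ 2 * α * n / Lr) (hD0 : 0 ≤ D) (hD : D ≤ θ * (n / lg ^ 2))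
    (hθ : θ = (c₀ * ε / 64) ^ 2 * η / (Lr * kr ^ 3 * α * C)) :
    2 * Real.log (2 * NL) / (s * J) * Real.sqrt (V / NL) *
        Real.sqrt (T * (kr * (2 * D * NL / (η * n) * (J * (C * n * Q))))) ≤ c₀ * n / 4 := by
  have hspos : 0 < s := lt_of_lt_of_le (mul_pos hε hQ) hs
  have hVpos : 0 < V := by rw [hV]; exact mul_pos hQ hJ
  have hLpos : 0 < Lr := by linarith
  have hkpos : 0 < kr := by linarith
  have hαpos : 0 < α := by linarith
  -- combine the square roots: `√(V/NL) √(T k (…)) = V √w`, `w = 2 T k D C / η`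
  set w : ℝ := 2 * T * kr * D * C / η with hw
  have hw0 : 0 ≤ w := by rw [hw]; positivity
  have hprod : V / NL * (T * (kr * (2 * D * NL / (η * n) * (J * (C * n * Q))))) = V ^ 2 * w := by
    rw [hw, hV]
    field_simp
  have hsqrt : Real.sqrt (V / NL) * Real.sqrt (T * (kr * (2 * D * NL / (η * n) * (J * (C * n * Q))))) =
      V * Real.sqrt w := by
    rw [← Real.sqrt_mul (by positivity), hprod, Real.sqrt_mul (sq_nonneg V), Real.sqrt_sq hVpos.le]
  -- `w ≤ (c₀ ε n/(32 Lr lg))²`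
  have hθpos : 0 < θ := by rw [hθ]; positivity
  have hw_le : w ≤ (c₀ * ε * n / (32 * Lr * lg)) ^ 2 := by
    have h1 : w ≤ 2 * (2 * kr ^ 2 * α * n / Lr) * kr * (θ * (n / lg ^ 2)) * C / η := by
      rw [hw]
      have hTD : T * D ≤ (2 * kr ^ 2 * α * n / Lr) * (θ * (n / lg ^ 2)) :=
        mul_le_mul hT hD hD0 (by positivity)
      have : 2 * T * kr * D * C / η = (T * D) * (2 * kr * C / η) := by ring
      rw [this]
      have : 2 * (2 * kr ^ 2 * α * n / Lr) * kr * (θ * (n / lg ^ 2)) * C / η =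
          ((2 * kr ^ 2 * α * n / Lr) * (θ * (n / lg ^ 2))) * (2 * kr * C / η) := by ring
      rw [this]
      exact mul_le_mul_of_nonneg_right hTD (by positivity)
    have h2 : 2 * (2 * kr ^ 2 * α * n / Lr) * kr * (θ * (n / lg ^ 2)) * C / η =
        (c₀ * ε * n / (32 * Lr * lg)) ^ 2 := by
      rw [hθ]
      field_simp
      ring
    linarith
  have hsqrt_w : Real.sqrt w ≤ c₀ * ε * n / (32 * Lr * lg) := by
    calc Real.sqrt w ≤ Real.sqrt ((c₀ * ε * n / (32 * Lr * lg)) ^ 2) := Real.sqrt_le_sqrt hw_le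
      _ = c₀ * ε * n / (32 * Lr * lg) := Real.sqrt_sq (by positivity)
  -- assemble
  calc 2 * Real.log (2 * NL) / (s * J) * Real.sqrt (V / NL) *
        Real.sqrt (T * (kr * (2 * D * NL / (η * n) * (J * (C * n * Q)))))
      = 2 * Real.log (2 * NL) / (s * J) * (V * Real.sqrt w) := by rw [mul_assoc, hsqrt]
    _ = 2 * Real.log (2 * NL) * (Q / s) * Real.sqrt w := by rw [hV]; field_simp
    _ ≤ 2 * (4 * Lr * lg) * (1 / ε) * (c₀ * ε * n / (32 * Lr * lg)) := by
        have hQs : Q / s ≤ 1 / ε := by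
          rw [div_le_div_iff₀ hspos hε]; linarith
        have hQs0 : 0 ≤ Q / s := by positivity
        gcongr
    _ = c₀ * n / 4 := by field_simp; ring


/-! ### Robust sign stability (appended) -/

/-- **Robust sign stability**: `d_H(sgn x, sgn x') ≤ #{v : |x v| < 1} + Σ_v (x v − x' v)²` — a sign
flip at a saturated coordinate costs at least `1` in the squared difference, unsaturated coordinates
are given up. -/
theorem vlr_hammingDist_le {n : ℕ} (x x' : Fin n → ℝ) :
    (hammingDist (fun v => decide (0 ≤ x v)) (fun v => decide (0 ≤ x' v)) : ℝ) ≤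
      ((univ.filter fun v : Fin n => |x v| < 1).card : ℝ) + ∑ v, (x v - x' v) ^ 2 := by
  rw [hammingDist]
  -- split the flipped coordinates into unsaturated and saturated ones
  have hsplit := Finset.card_filter_add_card_filter_not
    (s := univ.filter (fun v : Fin n => decide (0 ≤ x v) ≠ decide (0 ≤ x' v))) (fun v => |x v| < 1)
  have h1 : ((univ.filter (fun v : Fin n => decide (0 ≤ x v) ≠ decide (0 ≤ x' v))).filter
      (fun v => |x v| < 1)).card ≤ (univ.filter fun v : Fin n => |x v| < 1).card :=
    card_le_card fun v hv => by
      simp only [mem_filter, mem_univ, true_and] at hv ⊢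
      exact hv.2
  have hpt : ∀ v ∈ (univ.filter (fun v : Fin n => decide (0 ≤ x v) ≠ decide (0 ≤ x' v))).filter
      (fun v => ¬ |x v| < 1), (1 : ℝ) ≤ (x v - x' v) ^ 2 := by
    intro v hv
    simp only [mem_filter, mem_univ, true_and, not_lt] at hv
    have hne := hv.1
    have h1 := hv.2
    have key : 1 ≤ |x v - x' v| := by
      by_cases h0 : 0 ≤ x v
      · have h0' : ¬ 0 ≤ x' v := fun h' => hne (by rw [decide_eq_true h0, decide_eq_true h'])
        rw [abs_of_nonneg h0] at h1
        rw [abs_of_nonneg (by linarith)]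
        linarith
      · have h0' : 0 ≤ x' v := by
          by_contra h'
          exact hne (by rw [decide_eq_false h0, decide_eq_false h'])
        rw [abs_of_neg (not_le.1 h0)] at h1
        rw [abs_of_nonpos (by linarith)]
        linarith
    nlinarith [abs_nonneg (x v - x' v), sq_abs (x v - x' v)]
  have h2 : (((univ.filter (fun v : Fin n => decide (0 ≤ x v) ≠ decide (0 ≤ x' v))).filter
      (fun v => ¬ |x v| < 1)).card : ℝ) ≤ ∑ v, (x v - x' v) ^ 2 :=
    calc (((univ.filter (fun v : Fin n => decide (0 ≤ x v) ≠ decide (0 ≤ x' v))).filter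
          (fun v => ¬ |x v| < 1)).card : ℝ)
        = ∑ v ∈ (univ.filter (fun v : Fin n => decide (0 ≤ x v) ≠ decide (0 ≤ x' v))).filter
            (fun v => ¬ |x v| < 1), (1 : ℝ) := by simp
      _ ≤ ∑ v ∈ (univ.filter (fun v : Fin n => decide (0 ≤ x v) ≠ decide (0 ≤ x' v))).filter
            (fun v => ¬ |x v| < 1), (x v - x' v) ^ 2 := sum_le_sum hpt
      _ ≤ ∑ v, (x v - x' v) ^ 2 := sum_le_univ_sum_of_nonneg fun v => sq_nonneg _
  have h1' : (((univ.filter (fun v : Fin n => decide (0 ≤ x v) ≠ decide (0 ≤ x' v))).filter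
      (fun v => |x v| < 1)).card : ℝ) ≤ ((univ.filter fun v : Fin n => |x v| < 1).card : ℝ) := by
    exact_mod_cast h1
  have hsplit' : ((univ.filter (fun v : Fin n => decide (0 ≤ x v) ≠ decide (0 ≤ x' v))).card : ℝ) =
      (((univ.filter (fun v : Fin n => decide (0 ≤ x v) ≠ decide (0 ≤ x' v))).filter
        (fun v => |x v| < 1)).card : ℝ) +
      (((univ.filter (fun v : Fin n => decide (0 ≤ x v) ≠ decide (0 ≤ x' v))).filter
        (fun v => ¬ |x v| < 1)).card : ℝ) := by
    exact_mod_cast hsplit.symm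
  linarith

end Summit.PneNP.PneNP.Theorems
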